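import Literature.AlgebraicGeometry.Motives.FrobeniusSemisimpleOfSemisimpleGaloisRepresentation
import Mathlib.FieldTheory.Galois.Profinite
import Mathlib.FieldTheory.IsSepClosed
import Mathlib.Topology.Algebra.OpenSubgroup
import HarnessLib

/-!
# Tate classes over a finite field are fixed by a power of the Frobenius:
# `Tateᵖ(X) ⊆ ⋃ₙ Ker(φ_pⁿ − 1)`, indeed `⊆ Ker(φ_p^N − 1)` for one `N ≥ 1`

Topic `Literature/AlgebraicGeometry/Motives`; THEOREMS ONLY (no definition, no instance, no named
fact; D-0026).

J. Tate, *Conjectures on algebraic cycles in ℓ-adic cohomology* (1994) §1 defines the Tate classes of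
`H^{2p}(X)(p)` as the classes fixed by some OPEN subgroup of `Γ_k` — the tree's
`GaloisWeilCohomology.tateClasses E X p = smoothInvariants (E.ρTwist X (2p) p)`
(`mem_smoothInvariants_iff`: «fixed by every element of some open subgroup»).  Over a FINITE field
J. S. Milne (arXiv:0709.3040 §1, held, p. 3) writes the same space with the Frobenius:
«`H^{2r}(X, ℚ_ℓ(r))' := ⋃_{X₁/k₁} H^{2r}(X, ℚ_ℓ(r))^{Gal(𝔽/k₁)}`» (the union over the models over finite
subfields `k₁`, i.e. over the open subgroups `Gal(𝔽/k₁) = ` closure of `⟨π^{[k₁ : k]}⟩`), the classes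
fixed by some power of a Frobenius map `π`.

For the tree's abstract `E : GaloisWeilCohomology k K χ` over a finite field `k` this file proves the
inclusion that needs no continuity:

* §1 (group theory of `Γ_k`) **an open subgroup `U` of `Γ_k = Gal(k̄/k)` contains a positive power of
  every element**, in particular of the geometric Frobenius (`pow_index_mem_of_openSubgroup`,
  `exists_pow_geomFrob_mem`): `Γ_k` is compact (Krull topology, `k̄/k` Galois), so `U` has finite
  index `N`, and `U` is normal because `Γ_k` is abelian (row g38-#11 `absoluteGaloisGroup_mul_comm`),
  whence `g^N ∈ U`.
* §2 **`Tateᵖ(X) ⊆ ⋃ₙ Ker(φ_pⁿ − 1)`** (`exists_pow_ρTwist_geomFrob_apply_eq_of_mem_tateClasses`, for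
  every twist `smoothInvariants (E.ρTwist X i j)`), and for `X` smooth projective ONE exponent serves:
  **`Tateᵖ(X) ⊆ Ker(φ_p^N − 1)` for some `N ≥ 1`** (`exists_tateClasses_le_ker_pow_sub_one`; a finite
  spanning set, product of the exponents).  With the tree's `invariants_le_tateClasses`:
  `H^Γ ⊆ Tateᵖ(X) ⊆ Ker(φ_p^N − 1)`.

What this file does NOT do: the reverse inclusion `Ker(φⁿ − 1) ⊆ Tateᵖ(X)` needs the stabilisers of
classes to be open (continuity of `ρ`), not available for the abstract theory.  HC is not touched.

## Provenance

Lane `lit-hodgefound` (summit `HodgeConjecture`, Track 2 foundations library, Layer B: motives),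
seat `lit-hodgefound-p29` (literature-prover, generation 38, row g38-#18).
-/

universe u v

open CategoryTheory AlgebraicGeometry

noncomputable section

namespace Literature.AlgebraicGeometry.Motives

/-! ## §1 Open subgroups of `Γ_k`, `k` finite, contain a power of every element -/

/-- **An open subgroup of `Gal(k̄/k)`, `k` finite, contains `g^{[Γ_k : U]}` for every `g`**: `Γ_k` is
compact, so `U` has finite index, and normal since `Γ_k` is abelian.
[cite: SerreLocalFields1979, Ch. XIII §1] [cite: Tate1994, §1] -/
theorem pow_index_mem_of_openSubgroup {k : Type u} [Field k] [Finite k]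
    (U : OpenSubgroup (Field.absoluteGaloisGroup k)) (g : Field.absoluteGaloisGroup k) :
    g ^ (U : Subgroup (Field.absoluteGaloisGroup k)).index ∈ (U : Subgroup (Field.absoluteGaloisGroup k)) := by
  haveI : (U : Subgroup (Field.absoluteGaloisGroup k)).Normal :=
    ⟨fun n hn h ↦ by rwa [absoluteGaloisGroup_mul_comm h n, mul_inv_cancel_right]⟩
  exact Subgroup.pow_index_mem _ g

/-- **The index of an open subgroup of `Gal(k̄/k)` is finite (non-zero)**, `k` finite: `Gal(k̄/k)` is
compact for the Krull topology. [cite: SerreLocalFields1979, Ch. XIII §1] -/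
theorem index_ne_zero_of_openSubgroup {k : Type u} [Field k] [Finite k]
    (U : OpenSubgroup (Field.absoluteGaloisGroup k)) :
    (U : Subgroup (Field.absoluteGaloisGroup k)).index ≠ 0 := by
  haveI : IsGalois k (AlgebraicClosure k) := IsSepClosure.isGalois
  haveI : CompactSpace (Field.absoluteGaloisGroup k) :=
    inferInstanceAs <| CompactSpace (AlgebraicClosure k ≃ₐ[k] AlgebraicClosure k)
  haveI : Finite (Field.absoluteGaloisGroup k ⧸ (U : Subgroup (Field.absoluteGaloisGroup k))) :=
    Subgroup.quotient_finite_of_isOpen _ U.isOpen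
  haveI : (U : Subgroup (Field.absoluteGaloisGroup k)).FiniteIndex :=
    Subgroup.finiteIndex_of_finite_quotient
  exact Subgroup.FiniteIndex.index_ne_zero

/-- **Every open subgroup of `Gal(k̄/k)`, `k` finite, contains a positive power of the geometric
Frobenius** (and of any element). [cite: SerreLocalFields1979, Ch. XIII §1] [cite: Tate1994, §1] -/
theorem exists_pow_geomFrob_mem {k : Type u} [Field k] [Finite k]
    (U : OpenSubgroup (Field.absoluteGaloisGroup k)) :
    ∃ n : ℕ, 0 < n ∧ geomFrob k ^ n ∈ (U : Subgroup (Field.absoluteGaloisGroup k)) :=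
  ⟨_, Nat.pos_of_ne_zero (index_ne_zero_of_openSubgroup U), pow_index_mem_of_openSubgroup U _⟩

namespace GaloisWeilCohomology

variable {k : Type u} [Field k] [Finite k] {K : Type v} [Field K] [CharZero K]
  {χ : Field.absoluteGaloisGroup k →* Kˣ} (E : GaloisWeilCohomology k K χ)
variable {d : ℕ} {X : SchemeOver k}

/-! ## §2 Tate classes are fixed by a power of the Frobenius -/

/-- **A smooth invariant of `Hⁱ(X)(j)` is fixed by a positive power of the twisted Frobenius
`φ = χ(F)ʲ F`**: it is fixed by an open subgroup, which contains some `Fⁿ`, `n ≥ 1`.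
[cite: Tate1994, §1] [cite: Milne2007TateFiniteFieldsAIM, §1 (definition of H^{2r}(X, ℚ_ℓ(r))')] -/
theorem exists_pow_ρTwist_geomFrob_apply_eq_of_mem_smoothInvariants (X : SchemeOver k) (i : ℕ)
    (j : ℤ) {x : E.obj X i} (hx : x ∈ smoothInvariants (E.ρTwist X i j)) :
    ∃ n : ℕ, 0 < n ∧ (E.ρTwist X i j (geomFrob k) ^ n) x = x := by
  obtain ⟨U, hU⟩ := (mem_smoothInvariants_iff _ x).mp hx
  obtain ⟨n, hn, hmem⟩ := exists_pow_geomFrob_mem U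
  exact ⟨n, hn, by rw [← map_pow]; exact hU _ hmem⟩

/-- **`Tateᵖ(X) ⊆ ⋃ₙ Ker(φ_pⁿ − 1)`**: every Tate class is fixed by a positive power of the twisted
geometric Frobenius `φ_p = χ(F)ᵖ F` (Milne's description of the Tate classes over a finite field, the
inclusion that needs no continuity). [cite: Milne2007TateFiniteFieldsAIM, §1 (definition of H^{2r}(X, ℚ_ℓ(r))')]
[cite: Tate1994, §1] -/
theorem exists_pow_ρTwist_geomFrob_apply_eq_of_mem_tateClasses (X : SchemeOver k) (p : ℕ)
    {x : E.obj X (2 * p)} (hx : x ∈ E.tateClasses X p) :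
    ∃ n : ℕ, 0 < n ∧ (E.ρTwist X (2 * p) p (geomFrob k) ^ n) x = x :=
  E.exists_pow_ρTwist_geomFrob_apply_eq_of_mem_smoothInvariants X (2 * p) p hx

/-- The same as membership in a kernel: `x ∈ Ker(φ_pⁿ − 1)` for some `n ≥ 1`.
[cite: Milne2007TateFiniteFieldsAIM, §1] [cite: Tate1994, §1] -/
theorem exists_mem_ker_pow_sub_one_of_mem_tateClasses (X : SchemeOver k) (p : ℕ)
    {x : E.obj X (2 * p)} (hx : x ∈ E.tateClasses X p) :
    ∃ n : ℕ, 0 < n ∧ x ∈ LinearMap.ker (E.ρTwist X (2 * p) p (geomFrob k) ^ n - 1) := by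
  obtain ⟨n, hn, h⟩ := E.exists_pow_ρTwist_geomFrob_apply_eq_of_mem_tateClasses X p hx
  exact ⟨n, hn, by rw [LinearMap.mem_ker, LinearMap.sub_apply, Module.End.one_apply, h, sub_self]⟩

/-- If `φⁿ x = x` then `φ^{n m} x = x` (private helper). [folklore] -/
private theorem pow_mul_apply_eq {L : Type*} [CommRing L] {V : Type*} [AddCommGroup V] [Module L V]
    (φ : Module.End L V) {x : V} {n : ℕ} (h : (φ ^ n) x = x) (m : ℕ) : (φ ^ (n * m)) x = x := by
  induction m with
  | zero => rw [mul_zero, pow_zero, Module.End.one_apply]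
  | succ m ih => rw [Nat.mul_succ, pow_add, Module.End.mul_apply, h, ih]

/-- **ONE power of the Frobenius fixes all Tate classes**: for `X` smooth projective over a finite
field there is `N ≥ 1` with `Tateᵖ(X) ⊆ Ker(φ_p^N − 1)` (`Tateᵖ(X)` is finite-dimensional: take a
finite spanning set and the product of the exponents).
[cite: Milne2007TateFiniteFieldsAIM, §1 (H^{2r}(X, ℚ_ℓ(r))' = ⋃ over models X₁/k₁)] [cite: Tate1994, §1] -/
theorem exists_tateClasses_le_ker_pow_sub_one (hX : IsSmoothProjective d X) (p : ℕ) :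
    ∃ N : ℕ, 0 < N ∧
      E.tateClasses X p ≤ LinearMap.ker (E.ρTwist X (2 * p) p (geomFrob k) ^ N - 1) := by
  classical
  haveI := E.finite_obj hX (2 * p)
  set φ := E.ρTwist X (2 * p) p (geomFrob k) with hφ
  obtain ⟨s, hs⟩ := (Submodule.fg_iff_finiteDimensional _).mpr
    (inferInstance : FiniteDimensional K (E.tateClasses X p))
  -- exponents for the finitely many generators
  have hex : ∀ x ∈ s, ∃ n : ℕ, 0 < n ∧ (φ ^ n) x = x := fun x hx ↦
    E.exists_pow_ρTwist_geomFrob_apply_eq_of_mem_tateClasses X p (hs ▸ Submodule.subset_span hx)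
  choose! n hn hfix using hex
  refine ⟨∏ x ∈ s, n x, Finset.prod_pos fun x hx ↦ hn x hx, ?_⟩
  rw [← hs, Submodule.span_le]
  intro x hx
  obtain ⟨m, hm⟩ : n x ∣ ∏ y ∈ s, n y := Finset.dvd_prod_of_mem n hx
  change x ∈ LinearMap.ker (φ ^ (∏ y ∈ s, n y) - 1)
  rw [LinearMap.mem_ker, LinearMap.sub_apply, Module.End.one_apply, hm,
    pow_mul_apply_eq φ (hfix x hx) m, sub_self]

/-- **`H^{2p}(X)(p)^Γ ⊆ Tateᵖ(X) ⊆ Ker(φ_p^N − 1)`** for one `N ≥ 1` (`X` smooth projective over a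
finite field; the first inclusion is the tree's `invariants_le_tateClasses`).
[cite: Tate1994, §1] [cite: Milne2007TateFiniteFieldsAIM, §1] -/
theorem exists_invariants_le_tateClasses_le_ker_pow_sub_one (hX : IsSmoothProjective d X) (p : ℕ) :
    ∃ N : ℕ, 0 < N ∧ (E.ρTwist X (2 * p) p).invariants ≤ E.tateClasses X p ∧
      E.tateClasses X p ≤ LinearMap.ker (E.ρTwist X (2 * p) p (geomFrob k) ^ N - 1) := by
  obtain ⟨N, hN, hle⟩ := E.exists_tateClasses_le_ker_pow_sub_one hX p
  exact ⟨N, hN, E.invariants_le_tateClasses X p, hle⟩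

/-- **Algebraic classes are fixed by that power of the Frobenius too** (`K·Aᵖ(X) ⊆ H^Γ ⊆ Tateᵖ(X)`).
[cite: Tate1994, §1] [cite: Milne2007TateFiniteFieldsAIM, §1] -/
theorem exists_algebraicClasses_le_ker_pow_sub_one (hX : IsSmoothProjective d X) (p : ℕ) :
    ∃ N : ℕ, 0 < N ∧
      E.algebraicClasses X p ≤ LinearMap.ker (E.ρTwist X (2 * p) p (geomFrob k) ^ N - 1) := by
  obtain ⟨N, hN, hle⟩ := E.exists_tateClasses_le_ker_pow_sub_one hX p
  exact ⟨N, hN, ((E.algebraicClasses_le_invariants hX p).trans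
    (E.invariants_le_tateClasses X p)).trans hle⟩

end GaloisWeilCohomology

end Literature.AlgebraicGeometry.Motives

end
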